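import Literature.IUT.HodgeTheaters.CoveringsErrata
import Literature.AnabelianGeometry.AbsoluteAnabelian.TopFGOpenSubgroups
import Literature.AnabelianGeometry.AbsoluteAnabelian.SecondCountableExtension
import Literature.AnabelianGeometry.AbsoluteAnabelian.AbsTopISemiAbsolute
import HarnessLib

/-!
# [IUTchI] Remark 2.5.3 (ii) (E2) — discharged in print's form over the interface

Proof-only companion of `CoveringsErrata.lean` (abc-iut cell, layer L5, abc-iut-L5-t6; sibling of
`CoveringsErrataProofs.lean`), kurims manuscript [IUTchI] p. 53, Remark 2.5.3 (ii) (E2): "if `k` is a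
field whose absolute Galois group is Galois-countable, and `U` is a nonempty open subscheme of a
connected proper `k`-scheme `X` that arises as the underlying scheme of a log scheme that is log smooth
over `k` …, and whose interior is equal to `U`, then the tamely ramified arithmetic fundamental group of
`U` … is itself Galois-countable [cf., e.g., [AbsTopI], Proposition 2.2]."

* `Rmk253.tameGaloisCountable_of_geomTFG` — for every `1 → Δ → Π → G_k → 1` (abc-iut-L4-t1's
  `FundamentalExtension`) whose geometric group `Δ` is topologically finitely generated
  (abc-iut-L4-t4's `FundamentalExtension.GeomTFG` = [AbsTopI] Prop. 2.2, the bracketed reference of the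
  printed sentence), the (E2) predicate `TameGaloisCountable E` holds: `G_k` Galois-countable ⇒ `Π`
  Galois-countable (`AbsoluteAnabelian/TopFGOpenSubgroups.lean`: `Δ` has countably many open subgroups;
  `AbsoluteAnabelian/SecondCountableExtension.lean`: second countability of profinite extensions).
* `Rmk253.tameGaloisCountable_of_arith_tfg` — the trivial case `Π` itself topologically finitely
  generated.

Elementary; nothing here takes a side on [IUTchIII] Cor. 3.12.
-/

namespace Literature.IUT.HodgeTheaters

namespace Rmk253

universe u

/-- **[IUTchI] Remark 2.5.3 (ii) (E2)**, p. 53, DISCHARGED in print's form over the interface: for every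
`1 → Δ → Π → G_k → 1` whose `Δ` is topologically finitely generated (`GeomTFG`, [AbsTopI] Prop. 2.2),
`G_k` second countable ⇒ `Π` second countable. [cite: Mochizuki2012, IUTchI Rmk 2.5.3 (ii) (E2) p.53] -/
theorem tameGaloisCountable_of_geomTFG
    (E : AnabelianGeometry.AbsoluteAnabelian.FundamentalExtension.{u}) (h : E.GeomTFG) :
    TameGaloisCountable E := by
  intro hgal
  haveI : SecondCountableTopology E.gal := hgal
  haveI : CompactSpace E.geom := isCompact_iff_compactSpace.mp E.isClosed_geom.isCompact
  exact E.secondCountableTopology_arith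
    (AnabelianGeometry.AbsoluteAnabelian.IsTopologicallyFinitelyGenerated.countable_setOf_isOpen h)

/-- Instances of the model-relative **[IUTchI] Remark 2.5.3 (ii) (E2)** predicate in the trivial case:
`TameGaloisCountable E` holds whenever `Π = E.arith` is itself topologically finitely generated (a
topologically finitely generated profinite group is second countable).
[cite: Mochizuki2012, IUTchI Rmk 2.5.3 (ii) (E2) p.53] -/
theorem tameGaloisCountable_of_arith_tfg
    (E : AnabelianGeometry.AbsoluteAnabelian.FundamentalExtension.{u})
    (h : AnabelianGeometry.AbsoluteAnabelian.IsTopologicallyFinitelyGenerated E.arith) :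
    TameGaloisCountable E :=
  fun _ => h.secondCountableTopology

end Rmk253

end Literature.IUT.HodgeTheaters
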